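import Literature.AlgebraicGeometry.ComplexMultiplication.CurveTimesMultiquadraticCMWeights
import Literature.AlgebraicGeometry.Pohlmann1968.HodgeClassesProductSpanCMProductsSplit
import Literature.AlgebraicGeometry.Pohlmann1968.SimpleCMAbelianVarietyPowersDivisorGenerated
import Literature.AlgebraicGeometry.HodgeTheory.HodgeGroupProductCMFactor
import Literature.AlgebraicGeometry.HodgeTheory.HodgeClassesProductSpanTransport
import HarnessLib

/-!
# `E × Y` for `E` a CM elliptic curve and `Y` a NONDEGENERATE abelian variety with CM by a MULTIQUADRATIC CM field
# containing the CM field of `E`: every Hodge class on `E × Y` is a combination of exterior products, and the Hodge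
# conjecture holds for `E × Y` — although `Hg(E × Y) ⊊ Hg(E) × Hg(Y)`

COR-CM (cell `pub-hodgecm2`, binder seat `b25` gen 35, count-neutral claim PRODSPAN-POWERS (F15, part 2/2)); NEW as stated, hence
under `Summits/`.  Theorems only; no definition, no named fact, no `sorry`.

SETTING.  `K` a CM field, normal over `ℚ`, whose Galois group is COMMUTATIVE of EXPONENT `2` (a multiquadratic CM field
`ℚ(√-d, √a₁, …)`, e.g. `ℚ(ζ₂₄) = ℚ(i, √2, √3)`), `[K : ℚ] ≥ 4`; `k` an imaginary quadratic field with `j : k → K`;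
`Φ` a NONDEGENERATE CM type of `K` (`Pohlmann1968.IsNondegenerate`, i.e. `rank = [K:ℚ]/2 + 1`), `Φ_k` a CM type of `k`;
`(E, ι_E, θ_E)` a realisation of `(k; Φ_k)` (a CM elliptic curve) and `(Y, ι_Y, θ_Y)` one of `(K; Φ)`.

* **`hodgeClassesProductSpan_curve_multiquadratic`** — `HodgeTheory.HodgeClassesProductSpan E Y`: every rational
  Hodge class on `E × Y` is a `ℂ`-combination of exterior products `pr_E^* a ∪ pr_Y^* b` of rational Hodge classes.
* **`hodgeConjectureFor_curve_prod_multiquadratic`** — the Hodge conjecture for `E × Y`, UNCONDITIONALLY (`Y` is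
  nondegenerate, `E` is a curve; `HodgeTheory.hodgeConjectureFor_prod_of_productSpan`).

WHY THIS IS NEW.  The pair `(k ⊆ K)` shares the imaginary quadratic field `k`, so the family `{Φ_k, Φ}` is DEGENERATE
(`Hg(E × Y) ⊊ Hg(E) × Hg(Y)`; tree: `SharedImaginaryQuadraticFamilies`, seat b23), and by
`Pohlmann1968/HodgeClassesProductSpanCMProductsPowers` some `E^{a+1} × Y^{a+1}` carries a rational Hodge class OUTSIDE
the span of exterior products (the Weil classes of `k`; for `[K:ℚ] = 8` already `E² × Y`).  For a SEXTIC `K ⊇ k` the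
Weil class sits on `E × T` itself (`CorCM/CMEllipticCurveTimesSimpleCMThreefoldWeilClass`, seat b16); in exponent `2`
it does NOT — the parity obstruction `ComplexMultiplication.not_forall_card_filter_add_indicator_eq`: a mixed weight of
`E × Y` has ONE embedding of `k` and an ODD number of embeddings of `K`, an odd subset of an elementary abelian `2`-group
is seen by every `±1`-valued character, and the `k`-part is killed by an odd character non-trivial on `Gal(K/k)`.  So
Moonen–Zarhin's (3.1) needs POWERS even for CM abelian varieties: product span is NOT inherited by `X² × Y`.

PROOF.  By `Pohlmann1968.hodgeClassesProductSpan_biproduct_of_blocksSplit` (families over `Fin 1`) it suffices that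
every Galois-balanced weight `S ⊆ Hom(k,ℂ) ⊔ Hom(K,ℂ)` has balanced blocks.  If `|S ∩ Hom(k,ℂ)| ∈ {0, 2}` the `k`-block
is `∅` or `Hom(k,ℂ)` (balanced: a CM type takes exactly one of `τx, τx̄`) and the `K`-block is balanced by subtraction;
`|S ∩ Hom(k,ℂ)| = 1` is impossible (`not_balanced_of_card_toLeft_eq_one`): indexing `Hom(K,ℂ)` by `Gal(K/ℚ)`
(`Pohlmann1968.embOf`; `Aut(ℂ)` acts through `Gal(K/ℚ)` by translation) turns balance at the `τ_g` into
"`#{h ∈ T | hg ∈ Ψ} + [g c ∈ Gal(K/k)]` constant" (`Ψ` the type read on `Gal(K/ℚ)`, nondegenerate by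
`Pohlmann1968.isNondegenerate_iff_forall_oddCharacters`), excluded by the obstruction.

## References
* [MoonenZarhin1999LowDim] B. Moonen, Yu. Zarhin, Math. Ann. 315 (1999) 711–733, §3 (3.1), Thm. (0.2).
* [Kubota1965] T. Kubota, Trans. AMS 118 (1965), §4 Lemma 2.
* [Gordon1999HodgeAVSurvey] B. B. Gordon, *A survey of the Hodge conjecture for abelian varieties*, 7.5–7.7, 9.2, 9.4.
* [Shimura1998] G. Shimura, *Abelian Varieties with Complex Multiplication and Modular Functions*, §8.1, §18.2.

Provenance: Literature home (namespace `Literature.AlgebraicGeometry.ComplexMultiplication.Multiquadratic`) of the Summits-side `CorCM/CurveTimesMultiquadraticCMHodge` (cell `pub-hodgecm2`, COR-CM; all its imports are `Literature/`, Mathlib and the already re-homed `CurveTimesMultiquadraticCMWeights`), which `Literature/` may not import; theorems only, no named fact, no definition. Nothing here bears on `HC_CM`. Lane `lit-hodgefound` (Layer A3: CM types, their Kubota ranks and Galois combinatorics), seat p20.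
-/

noncomputable section

open _root_.CategoryTheory _root_.CategoryTheory.Limits NumberField

namespace Literature.AlgebraicGeometry.ComplexMultiplication.Multiquadratic

open Literature.AlgebraicGeometry.Motives (AbelianVariety CMType)
open Literature.AlgebraicGeometry.Motives.AbelianVariety
open Literature.AlgebraicGeometry.HodgeTheory
open Literature.AlgebraicGeometry.ComplexMultiplication (IsCMTypeRealisation)
open Literature.AlgebraicGeometry.Pohlmann1968
open Literature.NumberTheory.ComplexMultiplication

open scoped Classical

/-! ### The main theorem -/

section Main

variable {k : Type} [Field k] [NumberField k] [IsCMField k]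
  {K : Type} [Field K] [NumberField K] [Normal ℚ K]
  {Φk : CMType k} {Φ : CMType K}
  {E Y : AbelianVariety ℂ} {ιE : 𝓞 k →+* End E} {ιY : 𝓞 K →+* End Y}
  {θE : k →+* Module.End ℂ (complexBetti E.X 1)} {θY : K →+* Module.End ℂ (complexBetti Y.X 1)}

/-- `X ∼ ⨁_{Fin 1} X`. [cite: MumfordAV1970, §19 (products of abelian varieties)] -/
private theorem isIsogenous_biproduct_fin_one (X : AbelianVariety ℂ) : IsIsogenous X (⨁ fun _ : Fin 1 => X) :=
  isIsogenous_powSucc_biproduct X 0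

/-- **Every Hodge class on `E × Y` is a combination of exterior products** — `E` a CM elliptic curve with CM by the
imaginary quadratic field `k`, `Y` a NONDEGENERATE abelian variety with CM by a multiquadratic CM field `K ⊇ k`
(`K/ℚ` normal with commutative Galois group of exponent `2`, `[K:ℚ] ≥ 4`): `HodgeClassesProductSpan E Y`, although
`Hg(E × Y) ⊊ Hg(E) × Hg(Y)`. [cite: MoonenZarhin1999LowDim, §3 (3.1) and Thm. (0.2)] [cite: Kubota1965, §4 Lemma 2] -/
theorem hodgeClassesProductSpan_curve_multiquadratic (hk : Module.finrank ℚ k = 2) (j : k →+* K)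
    (hcomm : ∀ g h : K ≃ₐ[ℚ] K, g * h = h * g) (hexp : ∀ g : K ≃ₐ[ℚ] K, g * g = 1) (h4 : 4 ≤ Module.finrank ℚ K)
    (hnd : IsNondegenerate Φ) (hE : IsCMTypeRealisation Φk E ιE θE) (hY : IsCMTypeRealisation Φ Y ιY θY) :
    HodgeClassesProductSpan E Y := by
  refine HodgeClassesProductSpan.of_isIsogenous (isIsogenous_biproduct_fin_one E) (isIsogenous_biproduct_fin_one Y)
    (hodgeClassesProductSpan_biproduct_of_blocksSplit (K := fun _ : Fin 1 => k) (K' := fun _ : Fin 1 => K)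
      (Φ := fun _ => Φk) (Φ' := fun _ => Φ) (A := fun _ => E) (A' := fun _ => Y) (ι := fun _ => ιE)
      (ι' := fun _ => ιY) (θ := fun _ => θE) (θ' := fun _ => θY) (fun _ => hE) (fun _ => hY) fun S p hS => ?_)
  -- the two counts of each block
  have h1 : ∀ τ : ℂ ≃+* ℂ,
      {t | t ∈ S.toLeft ∧ (τ : ℂ →+* ℂ).comp t.2 ∈ Φk.1}.ncard + {y | y ∈ S.toRight ∧ (τ : ℂ →+* ℂ).comp y.2 ∈ Φ.1}.ncard = p :=
    fun τ => by
    have h := (hS τ).1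
    rw [ncard_sep_eq_add S] at h
    simpa only [Sum.elim_inl, Sum.elim_inr] using h
  have h2 : ∀ τ : ℂ ≃+* ℂ,
      {t | t ∈ S.toLeft ∧ ¬ (τ : ℂ →+* ℂ).comp t.2 ∈ Φk.1}.ncard +
        {y | y ∈ S.toRight ∧ ¬ (τ : ℂ →+* ℂ).comp y.2 ∈ Φ.1}.ncard = p := fun τ => by
    have h := (hS τ).2
    rw [ncard_sep_eq_add S] at h
    simpa only [Sum.elim_inl, Sum.elim_inr] using h
  -- the `K`-block is balanced with value `q` once the `k`-block counts are constant `= r` with `r + q = p`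
  have hK : ∀ r q : ℕ, (∀ τ : ℂ ≃+* ℂ, {t | t ∈ S.toLeft ∧ (τ : ℂ →+* ℂ).comp t.2 ∈ Φk.1}.ncard = r ∧
      {t | t ∈ S.toLeft ∧ ¬ (τ : ℂ →+* ℂ).comp t.2 ∈ Φk.1}.ncard = r) → r + q = p →
      S.toRight ∈ pohlmannSetsAlg (fun _ : Fin 1 => Φ) q := by
    intro r q hr hrq
    refine mem_pohlmannSetsAlg_iff.2 ⟨?_, isGaloisBalancedAlg_iff.2 fun τ => ?_⟩
    · have ht := ncard_add_ncard_not S.toRight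
        (fun y : (_ : Fin 1) × (K →+* ℂ) => ((1 : ℂ ≃+* ℂ) : ℂ →+* ℂ).comp y.2 ∈ Φ.1)
      have := h1 1; have := h2 1; have := (hr 1).1; have := (hr 1).2
      omega
    · have := h1 τ; have := h2 τ; have := (hr τ).1; have := (hr τ).2
      change {y | y ∈ S.toRight ∧ (τ : ℂ →+* ℂ).comp y.2 ∈ Φ.1}.ncard =
        {y | y ∈ S.toRight ∧ ¬ (τ : ℂ →+* ℂ).comp y.2 ∈ Φ.1}.ncard
      omega
  have hle : S.toLeft.card ≤ 2 := by
    refine (Finset.card_le_univ _).trans ?_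
    rw [Fintype.card_sigma, Finset.sum_const, Finset.card_univ, Fintype.card_fin, smul_eq_mul, one_mul,
      Embeddings.card, hk]
  rcases Nat.lt_or_ge S.toLeft.card 1 with h0 | h1'
  · -- `S ∩ Hom(k,ℂ) = ∅`
    have hempty : S.toLeft = ∅ := Finset.card_eq_zero.1 (by omega)
    refine ⟨0, p, by omega, mem_pohlmannSetsAlg_iff.2 ⟨by rw [hempty, Finset.card_empty], ?_⟩, hK 0 p ?_ (by omega)⟩
    · exact isGaloisBalancedAlg_iff.2 fun τ => by
        change {t | t ∈ S.toLeft ∧ (τ : ℂ →+* ℂ).comp t.2 ∈ Φk.1}.ncard =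
          {t | t ∈ S.toLeft ∧ ¬ (τ : ℂ →+* ℂ).comp t.2 ∈ Φk.1}.ncard
        rw [hempty, ncard_sep_empty, ncard_sep_empty]
    · intro τ
      rw [hempty, ncard_sep_empty, ncard_sep_empty]
      exact ⟨rfl, rfl⟩
  rcases Nat.lt_or_ge S.toLeft.card 2 with h1'' | h2'
  · -- exactly one embedding of `k`: impossible
    exact (not_balanced_of_card_toLeft_eq_one hk j hcomm hexp h4 hnd S p (by omega) hS).elim
  · -- `S ∩ Hom(k,ℂ) = Hom(k,ℂ)`
    have hcard2 : S.toLeft.card = 2 := le_antisymm hle h2'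
    have huniv : S.toLeft = Finset.univ :=
      Finset.eq_univ_of_card _ (by
        rw [hcard2, Fintype.card_sigma, Finset.sum_const, Finset.card_univ, Fintype.card_fin, smul_eq_mul, one_mul,
          Embeddings.card, hk])
    have hin : ∀ τ : ℂ ≃+* ℂ, {t | t ∈ S.toLeft ∧ (τ : ℂ →+* ℂ).comp t.2 ∈ Φk.1}.ncard = 1 := fun τ => by
      rw [huniv]; exact ncard_univ_sep_eq_one Φk hk τ
    have hout : ∀ τ : ℂ ≃+* ℂ, {t | t ∈ S.toLeft ∧ ¬ (τ : ℂ →+* ℂ).comp t.2 ∈ Φk.1}.ncard = 1 := fun τ => by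
      have ht := ncard_add_ncard_not S.toLeft (fun t : (_ : Fin 1) × (k →+* ℂ) => (τ : ℂ →+* ℂ).comp t.2 ∈ Φk.1)
      have := hin τ
      omega
    have hp : 1 ≤ p := by have := h1 1; have := hin 1; omega
    refine ⟨1, p - 1, by omega, mem_pohlmannSetsAlg_iff.2 ⟨by rw [hcard2], ?_⟩,
      hK 1 (p - 1) (fun τ => ⟨hin τ, hout τ⟩) (by omega)⟩
    exact isGaloisBalancedAlg_iff.2 fun τ => by
      change {t | t ∈ S.toLeft ∧ (τ : ℂ →+* ℂ).comp t.2 ∈ Φk.1}.ncard =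
        {t | t ∈ S.toLeft ∧ ¬ (τ : ℂ →+* ℂ).comp t.2 ∈ Φk.1}.ncard
      rw [hin τ, hout τ]

/-- **The Hodge conjecture for `E × Y`**, UNCONDITIONALLY: `E` a CM elliptic curve with CM field `k`, `Y` a
nondegenerate abelian variety with CM by a multiquadratic CM field `K ⊇ k` — a DEGENERATE pair (`Hg(E × Y) ⊊
Hg(E) × Hg(Y)`, exceptional classes on `E² × Y`) outside the divisor regime of the tree's product theorems.
[cite: MoonenZarhin1999LowDim, §3 (3.1) and Thm. (0.2)] [cite: Gordon1999HodgeAVSurvey, 7.5 and §9.3] -/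
theorem hodgeConjectureFor_curve_prod_multiquadratic [IsCMField K] (hk : Module.finrank ℚ k = 2) (j : k →+* K)
    (hcomm : ∀ g h : K ≃ₐ[ℚ] K, g * h = h * g) (hexp : ∀ g : K ≃ₐ[ℚ] K, g * g = 1) (h4 : 4 ≤ Module.finrank ℚ K)
    (hnd : IsNondegenerate Φ) (hE : IsCMTypeRealisation Φk E ιE θE) (hY : IsCMTypeRealisation Φ Y ιY θY) :
    HodgeConjectureFor (E.prod Y).dim (E.prod Y).X :=
  hodgeConjectureFor_prod_of_productSpan E Y
    (hodgeClassesProductSpan_curve_multiquadratic hk j hcomm hexp h4 hnd hE hY)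
    ((isNondegenerate_of_finrank_eq_two Φk hk).hodgeConjectureFor_powSucc hE 0)
    (hnd.hodgeConjectureFor_powSucc hY 0)

end Main

end Literature.AlgebraicGeometry.ComplexMultiplication.Multiquadratic

end
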